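import Mathlib.RepresentationTheory.Intertwining
import Mathlib.RepresentationTheory.Subrepresentation
import Mathlib.LinearAlgebra.Dimension.Constructions
import Mathlib.LinearAlgebra.Dimension.Finrank
import HarnessLib

/-!
# Intertwining maps into a direct sum: `Hom_G(ρ, σ ⊕ τ) ≅ Hom_G(ρ, σ) × Hom_G(ρ, τ)` and the rank bookkeeping

Generic representation theory over a field `k` (any monoid `G`), Mathlib-only, THEOREMS ONLY (def-free):

* §1 EXTERNAL direct sum: `Module.rank k (IntertwiningMap ρ (σ.prod τ)) = Module.rank k (IntertwiningMap ρ σ) +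
  Module.rank k (IntertwiningMap ρ τ)` (and the `finrank` form), through the in-proof linear equivalence
  `f ↦ (fst ∘ f, snd ∘ f)` with inverse `(f₁, f₂) ↦ f₁.prod f₂` (Mathlib's `IntertwiningMap.fst/snd/prod`).
* §2 INTERNAL direct sum: for a representation `R` of `G` on `X` and two `R`-stable submodules `P`, `Q` (Mathlib
  `Subrepresentation R`) with `P ⊓ Q = ⊥`, `Module.rank k (IntertwiningMap ρ (P ⊔ Q).toRepresentation) =
  Module.rank k (IntertwiningMap ρ P.toRepresentation) + Module.rank k (IntertwiningMap ρ Q.toRepresentation)`.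
* §3 the CURRENCY BRIDGE to «`k`-linear maps `θ : V → X` with values in `P` and `θ (ρ g v) = R g (θ v)`» (the shape in which
  function-space realisations are usually typed): `IntertwiningMap ρ P.toRepresentation` embeds `k`-linearly into `V →ₗ[k] X` by
  composition with `P.subtype`, with range exactly those `θ`.

These are the bookkeeping lemmas behind multiplicity statements of the form «`dim Hom_G(π, H^{1,0}) + dim Hom_G(π, H^{0,1})`»
when a `G`-module splits as an internal direct sum of two stable pieces (e.g. `H¹ = H^{1,0} ⊕ H^{0,1}`,
[BorelWallach2000, VII 3.6]); nothing beyond linear algebra is used: the statements are Bourbaki's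
`Hom_A(E, F₁ × F₂) = Hom_A(E, F₁) × Hom_A(E, F₂)` and «`P + Q` direct ⇔ `P ∩ Q = 0`» read at `A = k[G]` (Mathlib's
`Representation.IntertwiningMap.equivLinearMapAsModule` identifies `Hom_G` with `Hom_{k[G]}`).

## References
* [BourbakiAlgebre1a3] N. Bourbaki, *Algèbre, Chapitres 1 à 3*, Ch. II §1 no. 3 (submodules, canonical injection), no. 5 Prop. 4
  (universal property of the product: `Hom_A(E, F₁ × F₂) = Hom_A(E, F₁) × Hom_A(E, F₂)`; cf. no. 6 Cor. 1 to Prop. 6, formula (22)),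
  no. 8 Prop. 11 (a sum of two submodules is direct iff their intersection is `0`).
* [BorelWallach2000] A. Borel, N. Wallach, *Continuous cohomology, discrete subgroups, and representations of reductive
  groups*, 2nd ed. (2000), VII 3.6 (the bigraded decomposition whose multiplicities these lemmas count).
-/

namespace Literature.RepresentationTheory

open Representation Representation.IntertwiningMap

universe u v w

variable {k : Type u} [Field k] {G : Type v} [Monoid G]
variable {V W U X : Type w} [AddCommGroup V] [Module k V] [AddCommGroup W] [Module k W] [AddCommGroup U] [Module k U]
  [AddCommGroup X] [Module k X]

/-! ## §1 External direct sum -/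

/-- **`Hom_G(ρ, σ ⊕ τ) ≃ Hom_G(ρ, σ) × Hom_G(ρ, τ)`, `k`-linearly** (existence of the linear equivalence, with its action on
components: `f ↦ (fst ∘ f, snd ∘ f)`); Bourbaki's `Hom_A(E, F₁ × F₂) = Hom_A(E, F₁) × Hom_A(E, F₂)` at `A = k[G]`. [cite: BourbakiAlgebre1a3, Ch. II §1 no. 5 Prop. 4] -/
theorem exists_linearEquiv_intertwiningMap_prod (ρ : Representation k G V) (σ : Representation k G W)
    (τ : Representation k G U) :
    ∃ e : IntertwiningMap ρ (σ.prod τ) ≃ₗ[k] IntertwiningMap ρ σ × IntertwiningMap ρ τ,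
      ∀ f, e f = ((fst k σ τ).comp f, (snd k σ τ).comp f) := by
  refine ⟨{ toFun := fun f => ((fst k σ τ).comp f, (snd k σ τ).comp f)
            invFun := fun p => p.1.prod p.2
            map_add' := fun f g => by ext <;> rfl
            map_smul' := fun a f => by ext <;> rfl
            left_inv := fun f => by ext v <;> rfl
            right_inv := fun p => by ext <;> rfl }, fun f => rfl⟩

/-- **Rank additivity, external**: `rank Hom_G(ρ, σ ⊕ τ) = rank Hom_G(ρ, σ) + rank Hom_G(ρ, τ)`. [cite: BourbakiAlgebre1a3, Ch. II §1 no. 5 Prop. 4] -/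
theorem rank_intertwiningMap_prod (ρ : Representation k G V) (σ : Representation k G W) (τ : Representation k G U) :
    Module.rank k (IntertwiningMap ρ (σ.prod τ)) =
      Module.rank k (IntertwiningMap ρ σ) + Module.rank k (IntertwiningMap ρ τ) := by
  obtain ⟨e, -⟩ := exists_linearEquiv_intertwiningMap_prod ρ σ τ
  rw [e.rank_eq, rank_prod']

/-- **Finrank additivity, external** (both Hom-spaces finite-dimensional). [cite: BourbakiAlgebre1a3, Ch. II §1 no. 5 Prop. 4] -/
theorem finrank_intertwiningMap_prod (ρ : Representation k G V) (σ : Representation k G W) (τ : Representation k G U)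
    [Module.Finite k (IntertwiningMap ρ σ)] [Module.Finite k (IntertwiningMap ρ τ)] :
    Module.finrank k (IntertwiningMap ρ (σ.prod τ)) =
      Module.finrank k (IntertwiningMap ρ σ) + Module.finrank k (IntertwiningMap ρ τ) := by
  obtain ⟨e, -⟩ := exists_linearEquiv_intertwiningMap_prod ρ σ τ
  rw [e.finrank_eq, Module.finrank_prod]

/-- An intertwining map into `σ ⊕ τ` vanishes iff both components vanish. [cite: BourbakiAlgebre1a3, Ch. II §1 no. 5 Prop. 4] -/
theorem intertwiningMap_prod_eq_zero_iff {ρ : Representation k G V} {σ : Representation k G W} {τ : Representation k G U}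
    (f : IntertwiningMap ρ (σ.prod τ)) : f = 0 ↔ (fst k σ τ).comp f = 0 ∧ (snd k σ τ).comp f = 0 := by
  obtain ⟨e, he⟩ := exists_linearEquiv_intertwiningMap_prod ρ σ τ
  rw [← e.map_eq_zero_iff, he, Prod.mk_eq_zero]

/-! ## §2 Internal direct sum of two stable submodules -/

/-- The action of a subrepresentation, read in the ambient module: `↑(P.toRepresentation g x) = R g ↑x`. [cite: BourbakiAlgebre1a3, Ch. II §1 no. 3 (canonical injection of a submodule)] -/
theorem Subrepresentation.coe_toRepresentation_apply {R : Representation k G X} (P : Subrepresentation R) (g : G)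
    (x : P.toSubmodule) : ((P.toRepresentation g x : P.toSubmodule) : X) = R g (x : X) := rfl

/-- **The sum map `P × Q → P ⊔ Q` is bijective when `P ⊓ Q = ⊥`** (internal direct sum of two submodules: `P + Q` is direct iff `P ∩ Q = 0`). [cite: BourbakiAlgebre1a3, Ch. II §1 no. 8 Prop. 11] -/
theorem bijective_coprod_inclusion_of_disjoint (P Q : Submodule k X) (hPQ : Disjoint P Q) :
    Function.Bijective ((Submodule.inclusion (le_sup_left : P ≤ P ⊔ Q)).coprod
      (Submodule.inclusion (le_sup_right : Q ≤ P ⊔ Q))) := by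
  constructor
  · rw [← LinearMap.ker_eq_bot, LinearMap.ker_eq_bot']
    rintro ⟨x, y⟩ h
    have h' : (x : X) + (y : X) = 0 := by
      simpa [Submodule.coe_inclusion] using congrArg (Subtype.val) h
    have hx : (x : X) ∈ Q := by
      have : (x : X) = -(y : X) := eq_neg_of_add_eq_zero_left h'
      rw [this]; exact Q.neg_mem y.2
    have hx0 : (x : X) = 0 := (Submodule.disjoint_def.1 hPQ) _ x.2 hx
    have hy0 : (y : X) = 0 := by rwa [hx0, zero_add] at h'
    exact Prod.ext (Subtype.ext hx0) (Subtype.ext hy0)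
  · rintro ⟨z, hz⟩
    obtain ⟨x, hx, y, hy, rfl⟩ := Submodule.mem_sup.1 hz
    exact ⟨(⟨x, hx⟩, ⟨y, hy⟩), Subtype.ext (by simp [Submodule.coe_inclusion])⟩

/-- **`Hom_G(ρ, P ⊔ Q) ≃ Hom_G(ρ, P) × Hom_G(ρ, Q)`, `k`-linearly, for stable `P`, `Q` with `P ⊓ Q = ⊥`** (existence of the
linear equivalence; its first component post-composes with the projection `P ⊔ Q → P` along `Q`, read in `X`:
`↑((e f).1 v) + ↑((e f).2 v) = ↑(f v)`). [cite: BourbakiAlgebre1a3, Ch. II §1 no. 8 Prop. 11] [cite: BourbakiAlgebre1a3, Ch. II §1 no. 5 Prop. 4] -/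
theorem exists_linearEquiv_intertwiningMap_sup {R : Representation k G X} (ρ : Representation k G V)
    (P Q : Subrepresentation R) (hPQ : Disjoint P.toSubmodule Q.toSubmodule) :
    ∃ e : IntertwiningMap ρ (P ⊔ Q).toRepresentation ≃ₗ[k]
        IntertwiningMap ρ P.toRepresentation × IntertwiningMap ρ Q.toRepresentation,
      ∀ f v, (((e f).1 v : P.toSubmodule) : X) + (((e f).2 v : Q.toSubmodule) : X) = ((f v : (P ⊔ Q).toSubmodule) : X) := by
  -- the internal direct sum `P × Q ≃ P ⊔ Q`
  have hsup : (P ⊔ Q).toSubmodule = P.toSubmodule ⊔ Q.toSubmodule := Subrepresentation.toSubmodule_sup P Q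
  let φ : (P.toSubmodule × Q.toSubmodule) →ₗ[k] ↥(P.toSubmodule ⊔ Q.toSubmodule) :=
    (Submodule.inclusion (le_sup_left : P.toSubmodule ≤ P.toSubmodule ⊔ Q.toSubmodule)).coprod
      (Submodule.inclusion (le_sup_right : Q.toSubmodule ≤ P.toSubmodule ⊔ Q.toSubmodule))
  have hφ : Function.Bijective φ := bijective_coprod_inclusion_of_disjoint P.toSubmodule Q.toSubmodule hPQ
  let E : (P.toSubmodule × Q.toSubmodule) ≃ₗ[k] ↥(P ⊔ Q).toSubmodule :=
    (LinearEquiv.ofBijective φ hφ).trans (LinearEquiv.ofEq _ _ hsup.symm)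
  have hE : ∀ p : P.toSubmodule × Q.toSubmodule, ((E p : (P ⊔ Q).toSubmodule) : X) = (p.1 : X) + (p.2 : X) := by
    rintro ⟨x, y⟩
    simp [E, φ, Submodule.coe_inclusion]
  -- `E` and `E.symm` intertwine
  have hEf : ∀ g p, E ((P.toRepresentation.prod Q.toRepresentation) g p) = (P ⊔ Q).toRepresentation g (E p) := by
    intro g p
    apply Subtype.ext
    rw [Subrepresentation.coe_toRepresentation_apply, hE, hE, map_add]
    rfl
  have hEb : ∀ g z, E.symm ((P ⊔ Q).toRepresentation g z) = (P.toRepresentation.prod Q.toRepresentation) g (E.symm z) := by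
    intro g z
    apply E.injective
    rw [E.apply_symm_apply, hEf, E.apply_symm_apply]
  let Ef : IntertwiningMap (P.toRepresentation.prod Q.toRepresentation) (P ⊔ Q).toRepresentation :=
    LinearMap.intertwiningMap_of_isIntertwiningMap _ _ E.toLinearMap hEf
  let Eb : IntertwiningMap (P ⊔ Q).toRepresentation (P.toRepresentation.prod Q.toRepresentation) :=
    LinearMap.intertwiningMap_of_isIntertwiningMap _ _ E.symm.toLinearMap hEb
  -- Hom-level equivalence by post-composition, then the external splitting
  obtain ⟨e₀, he₀⟩ := exists_linearEquiv_intertwiningMap_prod ρ P.toRepresentation Q.toRepresentation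
  let H : IntertwiningMap ρ (P ⊔ Q).toRepresentation ≃ₗ[k] IntertwiningMap ρ (P.toRepresentation.prod Q.toRepresentation) :=
    LinearEquiv.ofLinear (llcomp ρ _ _ Eb) (llcomp ρ _ _ Ef)
      (by ext f v <;> simp [llcomp, Ef, Eb])
      (by ext f v; simp [llcomp, Ef, Eb])
  refine ⟨H.trans e₀, fun f v => ?_⟩
  have h1 : (H.trans e₀) f = e₀ (H f) := rfl
  rw [h1, he₀]
  change ((E.symm (f v)).1 : X) + ((E.symm (f v)).2 : X) = _
  rw [← hE, E.apply_symm_apply]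

/-- **Rank additivity, internal**: for `R`-stable `P`, `Q ≤ X` with `P ⊓ Q = ⊥`,
`rank Hom_G(ρ, P ⊔ Q) = rank Hom_G(ρ, P) + rank Hom_G(ρ, Q)`. [cite: BourbakiAlgebre1a3, Ch. II §1 no. 8 Prop. 11] [cite: BourbakiAlgebre1a3, Ch. II §1 no. 5 Prop. 4] -/
theorem rank_intertwiningMap_sup {R : Representation k G X} (ρ : Representation k G V) (P Q : Subrepresentation R)
    (hPQ : Disjoint P.toSubmodule Q.toSubmodule) :
    Module.rank k (IntertwiningMap ρ (P ⊔ Q).toRepresentation) =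
      Module.rank k (IntertwiningMap ρ P.toRepresentation) + Module.rank k (IntertwiningMap ρ Q.toRepresentation) := by
  obtain ⟨e, -⟩ := exists_linearEquiv_intertwiningMap_sup ρ P Q hPQ
  rw [e.rank_eq, rank_prod']

/-- **Finrank additivity, internal** (both Hom-spaces finite-dimensional). [cite: BourbakiAlgebre1a3, Ch. II §1 no. 8 Prop. 11] [cite: BourbakiAlgebre1a3, Ch. II §1 no. 5 Prop. 4] -/
theorem finrank_intertwiningMap_sup {R : Representation k G X} (ρ : Representation k G V) (P Q : Subrepresentation R)
    (hPQ : Disjoint P.toSubmodule Q.toSubmodule)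
    [Module.Finite k (IntertwiningMap ρ P.toRepresentation)] [Module.Finite k (IntertwiningMap ρ Q.toRepresentation)] :
    Module.finrank k (IntertwiningMap ρ (P ⊔ Q).toRepresentation) =
      Module.finrank k (IntertwiningMap ρ P.toRepresentation) + Module.finrank k (IntertwiningMap ρ Q.toRepresentation) := by
  obtain ⟨e, -⟩ := exists_linearEquiv_intertwiningMap_sup ρ P Q hPQ
  rw [e.finrank_eq, Module.finrank_prod]

/-- **Vanishing criterion, internal**: if `Hom_G(ρ, Q) = 0` then every `G`-map `ρ → P ⊔ Q` takes values in `P`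
(«the wrong type vanishes ⇒ the block has the right type»). [cite: BourbakiAlgebre1a3, Ch. II §1 no. 8 Prop. 11] -/
theorem intertwiningMap_sup_mem_left_of_subsingleton {R : Representation k G X} (ρ : Representation k G V)
    (P Q : Subrepresentation R) (hPQ : Disjoint P.toSubmodule Q.toSubmodule)
    (hQ : ∀ f : IntertwiningMap ρ Q.toRepresentation, f = 0) (f : IntertwiningMap ρ (P ⊔ Q).toRepresentation) (v : V) :
    ((f v : (P ⊔ Q).toSubmodule) : X) ∈ P.toSubmodule := by
  obtain ⟨e, he⟩ := exists_linearEquiv_intertwiningMap_sup ρ P Q hPQ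
  have h := he f v
  rw [hQ (e f).2] at h
  rw [← h]
  simp

/-! ## §3 The currency bridge: `Hom_G(ρ, P)` versus `P`-valued equivariant linear maps `V → X` -/

/-- **`Hom_G(ρ, P) ↪ Hom_k(V, X)` by composition with `P.subtype`**, `k`-linear and injective, with range EXACTLY the
`k`-linear `θ : V → X` taking values in `P` and satisfying `θ (ρ g v) = R g (θ v)` — the shape in which realisations in
function spaces are typed (a linear map `V → X` with values in the submodule `P` factors uniquely through the canonical injection `P → X`). [cite: BourbakiAlgebre1a3, Ch. II §1 no. 3 (canonical injection of a submodule)] -/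
theorem exists_embedding_intertwiningMap_toRepresentation {R : Representation k G X} (ρ : Representation k G V)
    (P : Subrepresentation R) :
    ∃ L : IntertwiningMap ρ P.toRepresentation →ₗ[k] (V →ₗ[k] X),
      Function.Injective L ∧ (∀ f, L f = P.toSubmodule.subtype ∘ₗ f.toLinearMap) ∧
        ∀ θ : V →ₗ[k] X, θ ∈ LinearMap.range L ↔ (∀ v, θ v ∈ P.toSubmodule) ∧ ∀ (g : G) (v : V), θ (ρ g v) = R g (θ v) := by
  let L : IntertwiningMap ρ P.toRepresentation →ₗ[k] (V →ₗ[k] X) :=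
    { toFun := fun f => P.toSubmodule.subtype ∘ₗ f.toLinearMap
      map_add' := fun f g => by ext; rfl
      map_smul' := fun a f => by ext; rfl }
  refine ⟨L, ?_, fun f => rfl, fun θ => ⟨?_, ?_⟩⟩
  · intro f g h
    apply IntertwiningMap.ext
    apply LinearMap.ext
    intro v
    exact Subtype.ext (LinearMap.congr_fun h v)
  · rintro ⟨f, rfl⟩
    refine ⟨fun v => (f v).2, fun g v => ?_⟩
    change ((f (ρ g v) : P.toSubmodule) : X) = R g ((f v : P.toSubmodule) : X)
    rw [← Subrepresentation.coe_toRepresentation_apply, IntertwiningMap.isIntertwining]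
  · rintro ⟨hθ, heq⟩
    refine ⟨LinearMap.intertwiningMap_of_isIntertwiningMap _ _ (θ.codRestrict P.toSubmodule hθ) fun g v => ?_, ?_⟩
    · exact Subtype.ext (by rw [Subrepresentation.coe_toRepresentation_apply]; simpa using heq g v)
    · ext v; rfl

/-- The bridge in the `∃`-form used by function-space realisations: a `P`-valued equivariant `θ : V →ₗ[k] X` IS
`P.subtype ∘ f` for a unique `f : Hom_G(ρ, P)`. [cite: BourbakiAlgebre1a3, Ch. II §1 no. 3 (canonical injection of a submodule)] -/
theorem existsUnique_intertwiningMap_subtype_comp_eq {R : Representation k G X} (ρ : Representation k G V)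
    (P : Subrepresentation R) (θ : V →ₗ[k] X) (hθ : ∀ v, θ v ∈ P.toSubmodule)
    (heq : ∀ (g : G) (v : V), θ (ρ g v) = R g (θ v)) :
    ∃! f : IntertwiningMap ρ P.toRepresentation, P.toSubmodule.subtype ∘ₗ f.toLinearMap = θ := by
  obtain ⟨L, hLinj, hL, hrange⟩ := exists_embedding_intertwiningMap_toRepresentation ρ P
  obtain ⟨f, hf⟩ := (hrange θ).2 ⟨hθ, heq⟩
  refine ⟨f, by simpa only [hL] using hf, fun f' hf' => hLinj ?_⟩
  rw [hL f', hf', hf]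

/-- Non-vanishing transfers across the bridge: `P.subtype ∘ f ≠ 0 ↔ f ≠ 0`. [cite: BourbakiAlgebre1a3, Ch. II §1 no. 3 (canonical injection of a submodule)] -/
theorem subtype_comp_ne_zero_iff {R : Representation k G X} {ρ : Representation k G V} (P : Subrepresentation R)
    (f : IntertwiningMap ρ P.toRepresentation) : P.toSubmodule.subtype ∘ₗ f.toLinearMap ≠ 0 ↔ f ≠ 0 := by
  obtain ⟨L, hLinj, hL, -⟩ := exists_embedding_intertwiningMap_toRepresentation ρ P
  rw [← hL, ne_eq, ne_eq, ← map_zero L, hLinj.eq_iff]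

end Literature.RepresentationTheory
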